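import Summits.KontsevichZagierPeriods.KontsevichZagierPeriods.Theses.LiouvilleUnfolding
import Literature.NumberTheory.Transcendental.KZLogCalculusProofs
import Literature.NumberTheory.Transcendental.RosenlichtProp4Residues
import Literature.NumberTheory.Transcendental.BakerLogarithmsConclusion
import Literature.ModelTheory.ExponentialFields.CylindricalDecompositionProofs

/-!
# Sketch — crux-ideate stmt-KontsevichZagierPeriods-2836 (LogPrimitiveNL), ideator 2, round 1

Idea card `horizontal-symbol-injectivity`. First lemmas of the line, stated over existing declarations
(nothing is proved here; this file only certifies that the signatures elaborate).

* `IdeaSketch.SemanticZero`      — the transfer `C⁺` (a KZlog term whose FUNCTION vanishes is a KZlog relation).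
* `IdeaSketch.Transfer`          — `C⁺ → LogPrimitiveNL` typechecks against the route decl.
* `IdeaSketch.HorizontalSubmodule` — the ∂-stable-subspace (Wronskian / Rosenlicht Prop. 6) lemma, pure linear algebra.
* `IdeaSketch.FunctionFieldBaker` — FIRST LEMMA of the line: `1, log w₁, …, log w_r` are linearly independent over the
  real-semialgebraic analytic functions on a connected open set as soon as no non-trivial power product of the `wₗ` is
  constant (Rosenlicht 1976 Prop. 4 ⊗ horizontality; in tree: `Rosenlicht.Rosenlicht1976_prop4_holds`, `ax_schanuel_holds`).
* `IdeaSketch.AdmissibleFold`    — the pure-KZ fold: a log symbol whose coefficient vector lies pointwise in the span of the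
  EXACT multiplicative relations of its arguments is a KZ relation (smallest-coefficient peeling; product rule in tree).
-/

namespace IdeaSketch

open Set MeasureTheory
open scoped BigOperators

open Literature.NumberTheory.Transcendental

-- in-tree facts the line leans on (names certified to resolve)
#check @Literature.NumberTheory.Transcendental.ax_schanuel_holds
#check @Literature.NumberTheory.Transcendental.Rosenlicht.Rosenlicht1976_prop4_holds
#check @Literature.NumberTheory.Transcendental.baker_holds
#check @Literature.NumberTheory.Transcendental.KZlog.Conservative_holds
#check @Literature.NumberTheory.Transcendental.KZlog.relations_eq_comap_unfold
#check @Literature.NumberTheory.Transcendental.KZlog.unfold_mem_of_mem_newtonLeibnizRel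
#check @Literature.NumberTheory.Transcendental.KZ.unfoldedLogStokes_mem_relations
#check @Literature.NumberTheory.Transcendental.KZ.of_sub_of_sub_mem_relations_mul
#check @Literature.NumberTheory.Transcendental.KZ.of_sub_of_mem_relations_fibreSubst
#check @Literature.NumberTheory.Transcendental.KZ.exists_isOpen_contDiffOn
#check @Literature.ModelTheory.ExponentialFields.IsSemialgebraic.exists_cylindricalDecomposition_holds

/-- Transfer form `C⁺` (KZlog.SemanticZero): a logarithmic representation `[σ; h₀; (hⱼ, vⱼ)ⱼ]` whose FUNCTION
`h₀ + Σ hⱼ log vⱼ` vanishes on `σ` is a relation of the nine-move logarithmic calculus (equivalently, by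
`KZlog.relations_eq_comap_unfold`, its unfolding `[σ,h₀] + Σⱼ [{1 ≤ s ≤ vⱼ}, hⱼ/s]` is a KZ relation). -/
def SemanticZero : Prop :=
  ∀ (n : ℕ) (T : KZlog.IntegralRep n), (∀ x ∈ T.domain, T.integrand x = 0) → KZlog.of T ∈ KZlog.relations

/-- The transfer stub typechecks against the route's crux decl. -/
def Transfer : Prop :=
  SemanticZero →
    Summit.KontsevichZagierPeriods.KontsevichZagierPeriods.Theses.LiouvilleUnfolding.LogPrimitiveNL

/-- Horizontality lemma (Rosenlicht 1976, Prop. 6 pattern; Ax 1971 proof of Thm 3): a `K`-subspace of `Kᵐ` stable under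
the coordinatewise action of a family of derivations is spanned by vectors with constant entries (reduced row-echelon
basis: the derivative of an echelon vector lies in the subspace and vanishes at every pivot, hence is zero). -/
def HorizontalSubmodule : Prop :=
  ∀ (K : Type) [Field K] (ι : Type) (D : ι → Derivation ℤ K K) (m : ℕ) (R : Submodule K (Fin m → K)),
    (∀ i, ∀ a ∈ R, (fun j => D i (a j)) ∈ R) →
      ∃ s : Finset (Fin m → K), (↑s : Set (Fin m → K)) ⊆ R ∧ (∀ a ∈ s, ∀ i j, D i (a j) = 0) ∧
        Submodule.span K (↑s : Set (Fin m → K)) = R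

/-- FIRST LEMMA (function-field Baker, real-analytic semialgebraic form). On a connected open `U ⊆ ℝⁿ`, if
`a₀, aₗ, wₗ` are real-semialgebraic (parameters allowed) and analytic, `wₗ > 0`, no non-trivial integer power product
of the `wₗ` is constant on `U`, and `a₀ + Σₗ aₗ log wₗ ≡ 0` on `U`, then `a₀ ≡ 0` and every `aₗ ≡ 0`.
Proof route: in the field of meromorphic germs at `p ∈ U`, `R = {a ∈ K₀ʳ | Σ aₗ log wₗ ∈ K₀}` (`K₀` = relative algebraic
closure of `ℝ(x)`) is a `∂`-stable `K₀`-subspace ⇒ constant basis (`HorizontalSubmodule`); a constant relation is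
`Σ cₗ dwₗ/wₗ = dv` in `Ω[K₀⁄ℝ]` (spanned by `dxᵢ`) ⇒ `Rosenlicht1976_prop4` ⇒ power products constant ⇒ `c = 0`. -/
def FunctionFieldBaker : Prop :=
  ∀ (n r : ℕ) (U : Set (Fin n → ℝ)) (a₀ : (Fin n → ℝ) → ℝ) (a w : Fin r → (Fin n → ℝ) → ℝ),
    IsOpen U → IsPreconnected U → U.Nonempty →
    IsSemialgebraicFunOn ℝ U a₀ → (∀ l, IsSemialgebraicFunOn ℝ U (a l)) →
    (∀ l, IsSemialgebraicFunOn ℝ U (w l)) →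
    AnalyticOnNhd ℝ a₀ U → (∀ l, AnalyticOnNhd ℝ (a l) U) → (∀ l, AnalyticOnNhd ℝ (w l) U) →
    (∀ l, ∀ x ∈ U, 0 < w l x) →
    (∀ μ : Fin r → ℤ, (∃ c : ℝ, ∀ x ∈ U, ∏ l, w l x ^ μ l = c) → μ = 0) →
    (∀ x ∈ U, a₀ x + ∑ l, a l x * Real.log (w l x) = 0) →
    (∀ x ∈ U, a₀ x = 0) ∧ ∀ l, ∀ x ∈ U, a l x = 0

/-- The inhomogeneous Baker step on an open set: positive real algebraic `γₖ`, multiplicatively independent, and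
`ℚ`-semialgebraic continuous `b₀, bₖ` with `b₀ + Σ bₖ log γₖ ≡ 0` on a non-empty open `U` ⇒ all vanish
(`baker_holds` at the dense rational points where the `b`'s take algebraic values, then continuity). -/
def BakerOnCells : Prop :=
  ∀ (n c : ℕ) (U : Set (Fin n → ℝ)) (γ : Fin c → ℝ) (b₀ : (Fin n → ℝ) → ℝ) (b : Fin c → (Fin n → ℝ) → ℝ),
    IsOpen U → (∀ k, 0 < γ k) → (∀ k, IsAlgebraic ℚ (γ k)) →
    (∀ ν : Fin c → ℤ, ∏ k, γ k ^ ν k = 1 → ν = 0) →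
    Literature.ModelTheory.ExponentialFields.IsSemialgebraic ℚ U →
    IsSemialgebraicFunOn ℚ U b₀ → (∀ k, IsSemialgebraicFunOn ℚ U (b k)) →
    ContinuousOn b₀ U → (∀ k, ContinuousOn (b k) U) →
    (∀ x ∈ U, b₀ x + ∑ k, b k x * Real.log (γ k) = 0) →
    (∀ x ∈ U, b₀ x = 0) ∧ ∀ k, ∀ x ∈ U, b k x = 0

/-- The pure-KZ ADMISSIBLE FOLD. Unfolded log monomials `Rⱼ = [{(x,s) | x ∈ σ, 1 ≤ s ≤ uⱼ x}, gⱼ(x)/s]` over a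
`ℚ`-semialgebraic base with `uⱼ ≥ 1`: if the coefficient vector `g(x)` lies, for every `x ∈ σ`, in the real span of the
integer vectors `μ` with `∏ⱼ uⱼ ^ μⱼ ≡ 1` on `σ` (exact multiplicative relations), then `Σⱼ [Rⱼ]` is a KZ relation.
Device: on the semialgebraic piece where `|g₁| ≤ |gⱼ|` for all `j`, peel `θ = g₁/d` along a relation `μ` with
`μ₁ = d = gcd`: every intermediate monomial `(θ, uⱼ)` has `|θ| log uⱼ ≤ |gⱼ| log uⱼ`, so it is an honest
`KZ.IntegralRep`; the rank-one fold is `KZ.of_sub_of_sub_mem_relations_mul`; induct on `k`. -/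
def AdmissibleFold : Prop :=
  ∀ (n k : ℕ) (σ : Set (Fin n → ℝ)) (g u : Fin k → (Fin n → ℝ) → ℝ) (R : Fin k → KZ.IntegralRep (n + 1)),
    Literature.ModelTheory.ExponentialFields.IsSemialgebraic ℚ σ →
    (∀ j, IsSemialgebraicFunOn ℚ σ (g j)) → (∀ j, IsSemialgebraicFunOn ℚ σ (u j)) →
    (∀ j, ∀ x ∈ σ, 1 ≤ u j x) →
    (∀ j, (R j).domain = KZlog.band σ (fun _ => 1) (u j)) →
    (∀ j, EqOn (R j).integrand (fun z => g j (Fin.init z) / z (Fin.last n)) (R j).domain) →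
    (∀ x ∈ σ, (fun j => g j x) ∈ Submodule.span ℝ
        ((fun μ : Fin k → ℤ => fun j => (μ j : ℝ)) ''
          {μ | ∀ y ∈ σ, ∏ j, u j y ^ μ j = 1})) →
    ∑ j, KZ.of (R j) ∈ KZ.relations

/-- How the pieces compose (informal): `FunctionFieldBaker ∧ BakerOnCells` ⇒ on every connected open analytic cell,
`h₀ ≡ 0` and `g(x) ∈ span M₁`; `AdmissibleFold` + domain additivity over an analytic cell decomposition ⇒
`SemanticZero`; `Transfer` ⇒ the crux. -/
def LineShape : Prop :=
  HorizontalSubmodule → FunctionFieldBaker → BakerOnCells → AdmissibleFold → SemanticZero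

end IdeaSketch
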